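import Mathlib

/-!
# Stub `stub_alReduction` — the Atkinson–Lloyd reduction to a primitive core

AtkinsonLloyd1981 (doi:10.1017/s144678870001795x), Theorem 1, first part (`stub_alReduction`).
Instead of the paper's induction on `m + n` we keep the index types.  Call a tuple
`(P, Q, BR, CR, BC, CC, ρ)` *good* if it satisfies every requirement of the statement except
exactness of `ρ` and the four primitivity conditions; `(1, 1, ∅, univ, ∅, univ, d)` is good.
Each failure of exactness / primitivity yields a good tuple of smaller measure `ρ + #CR + #CC`:
lower `ρ`; a common left-kernel vector of the cores is moved by a row operation to one core row,
which then vanishes outside the border columns and is deleted from `CR` (`rowKer`); if no core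
keeps rank `ρ` on a hyperplane `ker φ` of the core column space, a change of basis of the core
columns adapted to `ker φ` lets one core column join the border while `ρ` drops (`colPeel`); the
column / row duals follow by transposition (`supp_tr`, `core_tr`, `rank_tr`).  Hence a good tuple
of minimal measure is exact and primitive (`terminal`).  Everything is notation-free.
-/

set_option linter.dupNamespace false

namespace Summit.MatrixMultiplication.MatrixMultiplication.Cruxes.HiddenCornerLemmaR.AtkinsonLloydCoreSplit

open Matrix

namespace StubALReduction

/-! ### Elementary helpers -/

/-- A sum over `Fin N` of a function vanishing outside `A` is the sum over `A`. -/
theorem sum_eq_sum_coe {N : ℕ} (A : Finset (Fin N)) (g : Fin N → ℂ)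
    (hg : ∀ l, l ∉ A → g l = 0) : ∑ l, g l = ∑ k : A, g k := by
  rw [Finset.sum_coe_sort A g]
  exact (Finset.sum_subset (Finset.subset_univ A) fun l _ hl => hg l hl).symm

/-- The zero extension of `w : A → ℂ` times `X` is the `w`-combination of the rows `A` of `X`. -/
theorem dite_vecMul {N : ℕ} {A : Finset (Fin N)} {q : Type*} (w : A → ℂ)
    (X : Matrix (Fin N) q ℂ) (j : q) :
    ((fun l => if h : l ∈ A then w ⟨l, h⟩ else 0) ᵥ* X) j = ∑ k : A, w k * X k j := by
  simp only [vecMul, dotProduct]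
  rw [sum_eq_sum_coe A _ fun l hl => by rw [dif_neg hl, zero_mul]]
  simp

/-- `det (updateRow 1 k v) = v k`. -/
theorem det_updateRow_one {p : Type*} [Fintype p] [DecidableEq p] (k : p) (v : p → ℂ) :
    (updateRow (1 : Matrix p p ℂ) k v).det = v k := by
  have hv : v = ∑ l, v l • (1 : Matrix p p ℂ) l := by
    ext j; simp [Finset.sum_apply, Matrix.one_apply]
  conv_lhs => rw [hv]
  rw [det_updateRow_sum, det_one, smul_eq_mul, mul_one]

/-- Entries of `x ᵥ* updateRow 1 k v` (hence of `X * updateRow 1 k v`, taking `x := X i`). -/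
theorem vecMul_updateRow_one {q : Type*} [Fintype q] [DecidableEq q] (x : q → ℂ) (k : q)
    (v : q → ℂ) (j : q) :
    (x ᵥ* updateRow (1 : Matrix q q ℂ) k v) j = (if j = k then 0 else x j) + x k * v j := by
  simp only [vecMul, dotProduct, updateRow_apply]
  rw [Finset.sum_eq_add_sum_sdiff_singleton_of_mem (Finset.mem_univ k), if_pos rfl]
  rw [Finset.sum_congr rfl (g := fun l => if j = l then x j else 0) ?_]
  · rw [Finset.sum_ite_eq]
    by_cases hjk : j = k <;> simp [hjk, add_comm]
  · intro l hl
    have hlk : l ≠ k := by simpa using hl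
    rw [if_neg hlk, Matrix.one_apply]
    by_cases hlj : l = j
    · subst hlj; simp
    · simp [hlj, Ne.symm hlj]

/-- A matrix of rank `r` has `r` columns forming a submatrix of rank `r`. -/
theorem exists_submatrix_rank_eq {p q : Type*} [Fintype p] [Fintype q]
    (A : Matrix p q ℂ) {r : ℕ} (hr : A.rank = r) :
    ∃ g : Fin r → q, (A.submatrix id g).rank = r := by
  rw [rank_eq_finrank_span_cols] at hr
  subst hr
  obtain ⟨f, hf, -, hli⟩ := Submodule.exists_fun_fin_finrank_span_eq ℂ (Set.range A.col)
  choose g hg using fun i => Set.mem_range.1 (hf i)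
  refine ⟨g, ?_⟩
  have hli' : LinearIndependent ℂ (A.submatrix id g)ᵀ.row := by
    rw [show (A.submatrix id g)ᵀ.row = f from funext fun i => by rw [← hg i]; rfl]
    exact hli
  rw [← rank_transpose, hli'.rank_matrix, Fintype.card_fin]

/-! ### Transposition and the two row moves -/

variable {m n d : ℕ} {S : Set (Matrix (Fin m) (Fin n) ℂ)} {P : Matrix (Fin m) (Fin m) ℂ}
  {Q : Matrix (Fin n) (Fin n) ℂ} {BR CR : Finset (Fin m)} {BC CC : Finset (Fin n)} {ρ : ℕ}

/-- Transposing the equivalence transposes the cores. -/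
theorem core_tr (P : Matrix (Fin m) (Fin m) ℂ) (Q : Matrix (Fin n) (Fin n) ℂ) (CR : Finset (Fin m))
    (CC : Finset (Fin n)) (M : Matrix (Fin n) (Fin m) ℂ) :
    (Qᵀ * M * Pᵀ).submatrix (fun i : CC => (i : Fin n)) (fun j : CR => (j : Fin m)) =
      ((P * Mᵀ * Q).submatrix (fun i : CR => (i : Fin m)) (fun j : CC => (j : Fin n)))ᵀ := by
  simp [transpose_mul, Matrix.mul_assoc]

/-- The transposed core has the same rank. -/
theorem rank_tr (P : Matrix (Fin m) (Fin m) ℂ) (Q : Matrix (Fin n) (Fin n) ℂ) (CR : Finset (Fin m))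
    (CC : Finset (Fin n)) (M : Matrix (Fin m) (Fin n) ℂ) :
    ((Qᵀ * Mᵀ * Pᵀ).submatrix (fun i : CC => (i : Fin n)) (fun j : CR => (j : Fin m))).rank =
      ((P * M * Q).submatrix (fun i : CR => (i : Fin m)) (fun j : CC => (j : Fin n))).rank := by
  rw [core_tr, transpose_transpose, rank_transpose]

/-- The support condition transposes. -/
theorem supp_tr (hs : ∀ M ∈ S, ∀ (i : Fin m) (j : Fin n), (P * M * Q) i j ≠ 0 →
      i ∈ BR ∨ j ∈ BC ∨ (i ∈ CR ∧ j ∈ CC)) (M : Matrix (Fin n) (Fin m) ℂ) (hM : Mᵀ ∈ S)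
    (i : Fin n) (j : Fin m) (hij : (Qᵀ * M * Pᵀ) i j ≠ 0) : i ∈ BC ∨ j ∈ BR ∨ (i ∈ CC ∧ j ∈ CR) := by
  rw [show Qᵀ * M * Pᵀ = (P * Mᵀ * Q)ᵀ by simp [transpose_mul, Matrix.mul_assoc],
    transpose_apply] at hij
  rcases hs Mᵀ hM j i hij with h | h | h
  exacts [Or.inr (Or.inl h), Or.inl h, Or.inr (Or.inr ⟨h.2, h.1⟩)]

/-- Move (i): a common left-kernel vector `w ≠ 0` of the cores.  The row operation `E` replacing
row `i₀` (`w i₀ ≠ 0`) by the `w`-combination of the core rows is invertible, the new row `i₀`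
vanishes outside the border columns, so `i₀` may be deleted from the core rows. -/
theorem rowKer (hR : Disjoint BR CR)
    (hs : ∀ M ∈ S, ∀ (i : Fin m) (j : Fin n), (P * M * Q) i j ≠ 0 →
      i ∈ BR ∨ j ∈ BC ∨ (i ∈ CR ∧ j ∈ CC))
    (hr : ∀ M ∈ S, ((P * M * Q).submatrix (fun i : CR => (i : Fin m)) (fun j : CC => (j : Fin n))).rank ≤ ρ)
    (w : CR → ℂ) (hw0 : w ≠ 0)
    (hw : ∀ M ∈ S, w ᵥ* (P * M * Q).submatrix (fun i : CR => (i : Fin m)) (fun j : CC => (j : Fin n)) = 0) :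
    ∃ (E : Matrix (Fin m) (Fin m) ℂ) (i₀ : Fin m), IsUnit E ∧ i₀ ∈ CR ∧
      (∀ M ∈ S, ∀ (i : Fin m) (j : Fin n), (E * P * M * Q) i j ≠ 0 →
        i ∈ BR ∨ j ∈ BC ∨ (i ∈ CR.erase i₀ ∧ j ∈ CC)) ∧
      (∀ M ∈ S, ((E * P * M * Q).submatrix (fun i : ↥(CR.erase i₀) => (i : Fin m))
        (fun j : CC => (j : Fin n))).rank ≤ ρ) := by
  obtain ⟨i₀, hi₀⟩ := Function.ne_iff.1 hw0
  set wx : Fin m → ℂ := fun l => if h : l ∈ CR then w ⟨l, h⟩ else 0 with hwx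
  set E : Matrix (Fin m) (Fin m) ℂ := updateRow 1 (i₀ : Fin m) wx with hE
  have hEN : ∀ M : Matrix (Fin m) (Fin n) ℂ,
      E * P * M * Q = updateRow (P * M * Q) i₀ (wx ᵥ* (P * M * Q)) := fun M => by
    rw [Matrix.mul_assoc, Matrix.mul_assoc, ← Matrix.mul_assoc P, hE, updateRow_mul,
      Matrix.one_mul]
  have hrow : ∀ M ∈ S, ∀ j, j ∉ BC → (wx ᵥ* (P * M * Q)) j = 0 := by
    intro M hM j hj
    rw [hwx, dite_vecMul]
    by_cases hjC : j ∈ CC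
    · simpa [vecMul, dotProduct] using congr_fun (hw M hM) ⟨j, hjC⟩
    · refine Finset.sum_eq_zero fun k _ => ?_
      have : (P * M * Q) k j = 0 := by
        by_contra h
        rcases hs M hM k j h with h' | h' | h'
        exacts [Finset.disjoint_left.1 hR h' k.2, hj h', hjC h'.2]
      rw [this, mul_zero]
  refine ⟨E, i₀, ?_, i₀.2, fun M hM i j hij => ?_, fun M hM => ?_⟩
  · rw [isUnit_iff_isUnit_det, hE, det_updateRow_one, show wx i₀ = w i₀ by simp [hwx]]
    exact isUnit_iff_ne_zero.2 hi₀
  · rw [hEN M] at hij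
    by_cases hi : i = i₀
    · rw [hi, updateRow_self] at hij
      exact Or.inr (Or.inl (by_contra fun h => hij (hrow M hM j h)))
    · rw [updateRow_ne hi] at hij
      rcases hs M hM i j hij with h | h | h
      exacts [Or.inl h, Or.inr (Or.inl h), Or.inr (Or.inr ⟨Finset.mem_erase.2 ⟨hi, h.1⟩, h.2⟩)]
  · have : (E * P * M * Q).submatrix (fun i : ↥(CR.erase ↑i₀) => (i : Fin m))
        (fun j : CC => (j : Fin n)) =
        ((P * M * Q).submatrix (fun i : CR => (i : Fin m)) (fun j : CC => (j : Fin n))).submatrix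
          (fun i : ↥(CR.erase ↑i₀) => (⟨i, Finset.mem_of_mem_erase i.2⟩ : CR)) id := by
      ext i j
      have hi : (i : Fin m) ≠ i₀ := (Finset.mem_erase.1 i.2).1
      simp only [submatrix_apply, id]
      rw [hEN M, updateRow_ne hi]
    rw [this]
    exact (rank_submatrix_le _ _ _).trans (hr M hM)

/-- Move (iii): if for some `φ ≠ 0` no core keeps rank `ρ` on `ker φ` (no witness `B`), the
column operation `F` replacing the core columns `j ≠ j₀` (`φ j₀ ≠ 0`) by a basis of `ker φ` is
invertible, the new cores without column `j₀` have rank `≤ ρ - 1`, and `j₀` joins the border. -/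
theorem colPeel (h0 : (0 : Matrix (Fin m) (Fin n) ℂ) ∈ S) (hC : Disjoint BC CC)
    (hs : ∀ M ∈ S, ∀ (i : Fin m) (j : Fin n), (P * M * Q) i j ≠ 0 →
      i ∈ BR ∨ j ∈ BC ∨ (i ∈ CR ∧ j ∈ CC))
    (hr : ∀ M ∈ S, ((P * M * Q).submatrix (fun i : CR => (i : Fin m)) (fun j : CC => (j : Fin n))).rank ≤ ρ)
    (φ : CC → ℂ) (hφ0 : φ ≠ 0)
    (hφ : ∀ M ∈ S, ∀ B : Matrix CC (Fin ρ) ℂ, φ ᵥ* B = 0 →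
      ((P * M * Q).submatrix (fun i : CR => (i : Fin m)) (fun j : CC => (j : Fin n)) * B).rank ≠ ρ) :
    ∃ (F : Matrix (Fin n) (Fin n) ℂ) (j₀ : Fin n), IsUnit F ∧ j₀ ∈ CC ∧ j₀ ∉ BC ∧ 0 < ρ ∧
      (∀ M ∈ S, ∀ (i : Fin m) (j : Fin n), (P * M * (Q * F)) i j ≠ 0 →
        i ∈ BR ∨ j ∈ insert j₀ BC ∨ (i ∈ CR ∧ j ∈ CC.erase j₀)) ∧
      (∀ M ∈ S, ((P * M * (Q * F)).submatrix (fun i : CR => (i : Fin m))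
        (fun j : ↥(CC.erase j₀) => (j : Fin n))).rank ≤ ρ - 1) := by
  obtain ⟨j₀, hj₀⟩ := Function.ne_iff.1 hφ0
  have hj₀' : φ j₀ ≠ 0 := hj₀
  have hρ : ρ ≠ 0 := fun h => hφ 0 h0 0 (by simp) (by simp [h])
  set φx : Fin n → ℂ := fun l => if h : l ∈ CC then φ ⟨l, h⟩ else 0 with hφx
  set f : Fin n → ℂ := fun j => if j = (j₀ : Fin n) then 1 else -(φx j / φ j₀) with hf
  set F : Matrix (Fin n) (Fin n) ℂ := updateRow 1 (j₀ : Fin n) f with hF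
  have hj₀BC : (j₀ : Fin n) ∉ BC := fun h => Finset.disjoint_left.1 hC h j₀.2
  have hNF : ∀ (N : Matrix (Fin m) (Fin n) ℂ) (i : Fin m) (j : Fin n),
      (N * F) i j = (if j = (j₀ : Fin n) then 0 else N i j) + N i j₀ * f j :=
    fun N i j => vecMul_updateRow_one (N i) _ f j
  have hassoc : ∀ M : Matrix (Fin m) (Fin n) ℂ, P * M * (Q * F) = P * M * Q * F :=
    fun M => by simp only [Matrix.mul_assoc]
  refine ⟨F, j₀, ?_, j₀.2, hj₀BC, Nat.pos_of_ne_zero hρ, fun M hM i j hij => ?_, fun M hM => ?_⟩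
  · rw [isUnit_iff_isUnit_det, hF, det_updateRow_one]
    simp [hf]
  · rw [hassoc, hNF] at hij
    by_cases hj : j = (j₀ : Fin n)
    · exact Or.inr (Or.inl (by simp [hj]))
    rw [if_neg hj] at hij
    suffices h : i ∈ BR ∨ j ∈ BC ∨ (i ∈ CR ∧ j ∈ CC) by
      rcases h with h | h | h
      exacts [Or.inl h, Or.inr (Or.inl (Finset.mem_insert_of_mem h)),
        Or.inr (Or.inr ⟨h.1, Finset.mem_erase.2 ⟨hj, h.2⟩⟩)]
    by_cases h1 : (P * M * Q) i j = 0
    · rw [h1, zero_add] at hij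
      have hjCC : j ∈ CC := by
        by_contra h
        apply right_ne_zero_of_mul hij
        simp [hf, hj, hφx, h]
      rcases hs M hM i _ (left_ne_zero_of_mul hij) with h | h | h
      exacts [Or.inl h, absurd h hj₀BC, Or.inr (Or.inr ⟨h.1, hjCC⟩)]
    · exact hs M hM i j h1
  · set N := P * M * Q with hN
    let B₀ : Matrix CC ↥(CC.erase ↑j₀) ℂ := fun k j => F k j
    have hcore : (P * M * (Q * F)).submatrix (fun i : CR => (i : Fin m))
        (fun j : ↥(CC.erase ↑j₀) => (j : Fin n)) =
        N.submatrix (fun i : CR => (i : Fin m)) (fun j : CC => (j : Fin n)) * B₀ := by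
      ext i j
      have hjCC : (j : Fin n) ∈ CC := Finset.mem_of_mem_erase j.2
      rw [submatrix_apply, hassoc, ← hN, Matrix.mul_apply, Matrix.mul_apply]
      refine sum_eq_sum_coe CC (fun l => N i l * F l j) fun l hl => ?_
      have hl0 : l ≠ (j₀ : Fin n) := fun h => hl (h ▸ j₀.2)
      have hlj : l ≠ (j : Fin n) := fun h => hl (h ▸ hjCC)
      simp [hF, updateRow_ne hl0, one_apply_ne hlj]
    have hB₀ : ∀ j : ↥(CC.erase ↑j₀), (φ ᵥ* B₀) j = 0 := by
      intro j
      have hj : (j : Fin n) ≠ j₀ := (Finset.mem_erase.1 j.2).1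
      have hjCC : (j : Fin n) ∈ CC := (Finset.mem_erase.1 j.2).2
      have h1 : (φ ᵥ* B₀) j = (φx ᵥ* F) j := by
        rw [hφx, dite_vecMul]
        rfl
      have h2 : φx j = φ ⟨j, hjCC⟩ := dif_pos hjCC
      have h3 : φx j₀ = φ j₀ := by simp [hφx]
      rw [h1, hF, vecMul_updateRow_one, if_neg hj, h3]
      simp only [hf, if_neg hj, h2]
      linear_combination (-φ ⟨j, hjCC⟩) * mul_inv_cancel₀ hj₀'
    rw [hcore]
    by_contra hlt
    have hle : (N.submatrix (fun i : CR => (i : Fin m)) (fun j : CC => (j : Fin n)) * B₀).rank ≤ ρ :=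
      (rank_mul_le_left _ B₀).trans (hr M hM)
    obtain ⟨k, hk⟩ := exists_submatrix_rank_eq
      (N.submatrix (fun i : CR => (i : Fin m)) (fun j : CC => (j : Fin n)) * B₀) (r := ρ) (by omega)
    refine hφ M hM (B₀.submatrix id k) (funext fun t => hB₀ (k t)) ?_
    rwa [← submatrix_id_id (N.submatrix _ _), ← submatrix_mul _ B₀ _ id _ Function.bijective_id]

/-! ### Descent -/

/-- A good tuple of minimal measure `ρ + #CR + #CC` is exact and primitive, so every good tuple
leads to an exact primitive one (moves 0, (i)–(iv); (ii), (iv) by transposing (i), (iii)). -/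
theorem terminal (h0 : (0 : Matrix (Fin m) (Fin n) ℂ) ∈ S) : ∀ (k : ℕ)
    (P : Matrix (Fin m) (Fin m) ℂ) (Q : Matrix (Fin n) (Fin n) ℂ) (BR CR : Finset (Fin m))
    (BC CC : Finset (Fin n)) (ρ : ℕ), IsUnit P → IsUnit Q → Disjoint BR CR → Disjoint BC CC →
    BR.card + BC.card + ρ ≤ d →
    (∀ M ∈ S, ∀ (i : Fin m) (j : Fin n), (P * M * Q) i j ≠ 0 →
      i ∈ BR ∨ j ∈ BC ∨ (i ∈ CR ∧ j ∈ CC)) →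
    (∀ M ∈ S, ((P * M * Q).submatrix (fun i : CR => (i : Fin m)) (fun j : CC => (j : Fin n))).rank ≤ ρ) →
    ρ + CR.card + CC.card < k →
    ∃ (P : Matrix (Fin m) (Fin m) ℂ) (Q : Matrix (Fin n) (Fin n) ℂ), IsUnit P ∧ IsUnit Q ∧
      ∃ (BR CR : Finset (Fin m)) (BC CC : Finset (Fin n)) (ρ : ℕ),
        Disjoint BR CR ∧ Disjoint BC CC ∧ BR.card + BC.card + ρ ≤ d ∧
        (∀ M ∈ S, ∀ (i : Fin m) (j : Fin n), (P * M * Q) i j ≠ 0 →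
          i ∈ BR ∨ j ∈ BC ∨ (i ∈ CR ∧ j ∈ CC)) ∧
        (∀ M ∈ S, ((P * M * Q).submatrix (fun i : CR => (i : Fin m)) (fun j : CC => (j : Fin n))).rank ≤ ρ) ∧
        (∃ M ∈ S, ((P * M * Q).submatrix (fun i : CR => (i : Fin m)) (fun j : CC => (j : Fin n))).rank = ρ) ∧
        (∀ w : CR → ℂ, (∀ M ∈ S, Matrix.vecMul w
          ((P * M * Q).submatrix (fun i : CR => (i : Fin m)) (fun j : CC => (j : Fin n))) = 0) → w = 0) ∧
        (∀ v : CC → ℂ, (∀ M ∈ S, Matrix.mulVec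
          ((P * M * Q).submatrix (fun i : CR => (i : Fin m)) (fun j : CC => (j : Fin n))) v = 0) → v = 0) ∧
        (∀ φ : CC → ℂ, φ ≠ 0 → ∃ M ∈ S, ∃ B : Matrix CC (Fin ρ) ℂ, Matrix.vecMul φ B = 0 ∧
          (((P * M * Q).submatrix (fun i : CR => (i : Fin m)) (fun j : CC => (j : Fin n))) * B).rank = ρ) ∧
        (∀ ψ : CR → ℂ, ψ ≠ 0 → ∃ M ∈ S, ∃ C : Matrix (Fin ρ) CR ℂ, Matrix.mulVec C ψ = 0 ∧
          (C * ((P * M * Q).submatrix (fun i : CR => (i : Fin m)) (fun j : CC => (j : Fin n)))).rank = ρ) := by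
  intro k
  induction k with
  | zero => intros; omega
  | succ k ih =>
    intro P Q BR CR BC CC ρ hP hQ hR hC hb hs hr hk
    by_cases hmin : ∃ (P' : Matrix (Fin m) (Fin m) ℂ) (Q' : Matrix (Fin n) (Fin n) ℂ)
        (BR' CR' : Finset (Fin m)) (BC' CC' : Finset (Fin n)) (ρ' : ℕ), IsUnit P' ∧ IsUnit Q' ∧
        Disjoint BR' CR' ∧ Disjoint BC' CC' ∧ BR'.card + BC'.card + ρ' ≤ d ∧
        (∀ M ∈ S, ∀ (i : Fin m) (j : Fin n), (P' * M * Q') i j ≠ 0 →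
          i ∈ BR' ∨ j ∈ BC' ∨ (i ∈ CR' ∧ j ∈ CC')) ∧
        (∀ M ∈ S, ((P' * M * Q').submatrix (fun i : CR' => (i : Fin m))
          (fun j : CC' => (j : Fin n))).rank ≤ ρ') ∧ ρ' + CR'.card + CC'.card < ρ + CR.card + CC.card
    · obtain ⟨P', Q', BR', CR', BC', CC', ρ', hP', hQ', hR', hC', hb', hs', hr', hμ⟩ := hmin
      exact ih P' Q' BR' CR' BC' CC' ρ' hP' hQ' hR' hC' hb' hs' hr' (by omega)
    refine ⟨P, Q, hP, hQ, BR, CR, BC, CC, ρ, hR, hC, hb, hs, hr, ?_, fun w hw => ?_, fun v hv => ?_,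
      fun φ hφ0 => ?_, fun ψ hψ0 => ?_⟩ <;> by_contra h <;> push Not at h <;> refine hmin ?_
    · -- move 0: no core attains rank `ρ`, lower `ρ`
      have hρ : ρ ≠ 0 := fun hρ => h 0 h0 (by simp [hρ])
      exact ⟨P, Q, BR, CR, BC, CC, ρ - 1, hP, hQ, hR, hC, by omega, hs,
        fun M hM => by have := hr M hM; have := h M hM; omega, by omega⟩
    · -- move (i)
      obtain ⟨E, i₀, hE, hi₀, hs', hr'⟩ := rowKer hR hs hr w h hw
      exact ⟨E * P, Q, BR, CR.erase i₀, BC, CC, ρ, hE.mul hP, hQ,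
        hR.mono_right (Finset.erase_subset _ _), hC, hb, hs', hr',
        by have := Finset.card_erase_lt_of_mem hi₀; omega⟩
    · -- move (ii) = move (i) transposed
      obtain ⟨E, j₀, hE, hj₀, hs', hr'⟩ := rowKer (S := {M : Matrix (Fin n) (Fin m) ℂ | Mᵀ ∈ S})
        hC (supp_tr hs) (fun M hM => by simpa using (rank_tr P Q CR CC Mᵀ).trans_le (hr Mᵀ hM))
        v h (fun M hM => by rw [core_tr, vecMul_transpose]; exact hv Mᵀ hM)
      refine ⟨P, Q * Eᵀ, BR, CR, BC, CC.erase j₀, ρ, hP, hQ.mul ((Matrix.isUnit_transpose E).2 hE), hR,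
        hC.mono_right (Finset.erase_subset _ _), hb, by simpa [transpose_mul] using supp_tr hs',
        fun M hM => ?_, by have := Finset.card_erase_lt_of_mem hj₀; omega⟩
      rw [← rank_tr]
      simpa [transpose_mul] using hr' Mᵀ (by simpa using hM)
    · -- move (iii)
      obtain ⟨F, j₀, hF, hj₀, hj₀', hρ, hs', hr'⟩ := colPeel h0 hC hs hr φ hφ0 h
      exact ⟨P, Q * F, BR, CR, insert j₀ BC, CC.erase j₀, ρ - 1, hP, hQ.mul hF, hR,
        Finset.disjoint_insert_left.2 ⟨Finset.notMem_erase _ _, hC.mono_right (Finset.erase_subset _ _)⟩,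
        by rw [Finset.card_insert_of_notMem hj₀']; omega, hs', hr',
        by have := Finset.card_erase_lt_of_mem hj₀; omega⟩
    · -- move (iv) = move (iii) transposed
      obtain ⟨F, i₀, hF, hi₀, hi₀', hρ, hs', hr'⟩ := colPeel (S := {M : Matrix (Fin n) (Fin m) ℂ | Mᵀ ∈ S})
        (by simpa using h0) hR (supp_tr hs)
        (fun M hM => by simpa using (rank_tr P Q CR CC Mᵀ).trans_le (hr Mᵀ hM)) ψ hψ0
        (fun M hM B hB => by
          rw [core_tr, ← transpose_transpose B, ← transpose_mul, rank_transpose]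
          exact h Mᵀ hM Bᵀ (by rw [mulVec_transpose]; exact hB))
      refine ⟨Fᵀ * P, Q, insert i₀ BR, CR.erase i₀, BC, CC, ρ - 1, ((Matrix.isUnit_transpose F).2 hF).mul hP,
        hQ, Finset.disjoint_insert_left.2 ⟨Finset.notMem_erase _ _, hR.mono_right (Finset.erase_subset _ _)⟩,
        hC, by rw [Finset.card_insert_of_notMem hi₀']; omega, by simpa [transpose_mul] using supp_tr hs',
        fun M hM => ?_, by have := Finset.card_erase_lt_of_mem hi₀; omega⟩
      rw [← rank_tr]
      simpa [transpose_mul] using hr' Mᵀ (by simpa using hM)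

end StubALReduction

open StubALReduction in
/-- **stub 1a — `stub_alReduction`: Atkinson–Lloyd reduction to a PRIMITIVE core**
(AtkinsonLloyd1981 = doi:10.1017/s144678870001795x, Theorem 1, first part, p. 475, proof p. 478;
primitivity = the four conditions of p. 474 / Atkinson1983 p. 307).
After a constant equivalence `M ↦ P M Q` every `M ∈ V` is supported on
`BR × all ∪ all × BC ∪ CR × CC`, `#BR + #BC + ρ ≤ d` where `ρ` is the EXACT upper rank of the
core space `{(P M Q)|CR × CC : M ∈ V}`, and the core space is primitive: (i) no common left kernel
vector, (ii) no common right kernel vector, (iii) on every hyperplane `ker φ` of the column space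
some core keeps rank `ρ`, (iv) modulo every line `ℂ ψ` of the row space some core keeps rank `ρ`
((iii)/(iv) with explicit witnesses `B`, `C` of the restricted rank).
Proof: the good tuple `(1, 1, ∅, univ, ∅, univ, d)` descends to one of minimal measure, which is
exact and primitive (`StubALReduction.terminal`). -/
theorem stub_alReduction :
    ∀ (m n d : ℕ) (V : Submodule ℂ (Matrix (Fin m) (Fin n) ℂ)), (∀ M ∈ V, M.rank ≤ d) →
    ∃ (P : Matrix (Fin m) (Fin m) ℂ) (Q : Matrix (Fin n) (Fin n) ℂ), IsUnit P ∧ IsUnit Q ∧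
      ∃ (BR CR : Finset (Fin m)) (BC CC : Finset (Fin n)) (ρ : ℕ),
        Disjoint BR CR ∧ Disjoint BC CC ∧ BR.card + BC.card + ρ ≤ d ∧
        (∀ M ∈ V, ∀ (i : Fin m) (j : Fin n), (P * M * Q) i j ≠ 0 →
          i ∈ BR ∨ j ∈ BC ∨ (i ∈ CR ∧ j ∈ CC)) ∧
        (∀ M ∈ V, ((P * M * Q).submatrix (fun i : CR => (i : Fin m)) (fun j : CC => (j : Fin n))).rank ≤ ρ) ∧
        (∃ M ∈ V, ((P * M * Q).submatrix (fun i : CR => (i : Fin m)) (fun j : CC => (j : Fin n))).rank = ρ) ∧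
        (∀ w : CR → ℂ, (∀ M ∈ V, Matrix.vecMul w
          ((P * M * Q).submatrix (fun i : CR => (i : Fin m)) (fun j : CC => (j : Fin n))) = 0) → w = 0) ∧
        (∀ v : CC → ℂ, (∀ M ∈ V, Matrix.mulVec
          ((P * M * Q).submatrix (fun i : CR => (i : Fin m)) (fun j : CC => (j : Fin n))) v = 0) → v = 0) ∧
        (∀ φ : CC → ℂ, φ ≠ 0 → ∃ M ∈ V, ∃ B : Matrix CC (Fin ρ) ℂ, Matrix.vecMul φ B = 0 ∧
          (((P * M * Q).submatrix (fun i : CR => (i : Fin m)) (fun j : CC => (j : Fin n))) * B).rank = ρ) ∧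
        (∀ ψ : CR → ℂ, ψ ≠ 0 → ∃ M ∈ V, ∃ C : Matrix (Fin ρ) CR ℂ, Matrix.mulVec C ψ = 0 ∧
          (C * ((P * M * Q).submatrix (fun i : CR => (i : Fin m)) (fun j : CC => (j : Fin n)))).rank = ρ) := by
  intro m n d V hV
  exact terminal (S := (V : Set (Matrix (Fin m) (Fin n) ℂ))) V.zero_mem _ 1 1 ∅ Finset.univ ∅
    Finset.univ d isUnit_one isUnit_one (Finset.disjoint_empty_left _) (Finset.disjoint_empty_left _)
    (by simp) (fun M _ i j _ => Or.inr (Or.inr ⟨Finset.mem_univ _, Finset.mem_univ _⟩))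
    (fun M hM => (rank_submatrix_le _ _ _).trans (by simpa using hV M hM)) (Nat.lt_succ_self _)

end Summit.MatrixMultiplication.MatrixMultiplication.Cruxes.HiddenCornerLemmaR.AtkinsonLloydCoreSplit
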